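import Literature.AnabelianGeometry.SemiGraphs.AmbientVocabOfReal
import Literature.AnabelianGeometry.SemiGraphs.ArithmeticCoverings

/-!
# `LocalAdjectives.ofReal`: the Def 5.1 (iii) container of local adjectives at the real vocabulary ([SemiAnbd] Def 2.4, Def 5.1 (iii))

Mochizuki, *Semi-graphs of anabelioids*, Publ. RIMS **42** (2006), §2 Def 2.4 (i), (iii), (iv)
pp.25–26 (elevated vertices; sub-coverticial / universally sub-coverticial closed edges; aloof /
estranged edges), §5 Def 5.1 (iii) p.63 (the same adjectives for arithmetic semi-graphs of
anabelioids, via the geometric components) (kurims `paper:url-f33ace170ff4`).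
[cite: MochizukiSemiAnbd2006, Def 5.1 (iii), p. 63]

MERGE, second container (L3 bridge, continuing `AmbientVocabOfReal.lean`): `ArithmeticCoverings.lean`
types Def 5.1 (iii) over a stub-container `LocalAdjectives 𝓥` of per-vertex / per-edge predicates
("TODO-merge abc-iut-L3-t1").  At `𝓥 := SemiAnbdVocab.ofReal R` every field is t1's real predicate
(`SemiGraphOfAnabelioids.IsElevated`, `IsSubCoverticial`, `IsUniversallySubCoverticial`, `IsAloof`,
`IsEstranged` of `Commensurability.lean` / `Coverticial.lean`): `LocalAdjectives.ofReal R`, with NO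
residual.  Consistency with the global predicates of the first container (PROVED, all definitional
unfoldings of t1's `@[mk_iff]` structures): totally elevated ↔ elevated at every vertex; totally
estranged ↔ estranged at every edge; totally universally sub-coverticial ↔ universally
sub-coverticial at every closed edge; totally aloof (an `SgA` object always is) ⇒ aloof at every edge;
estranged at `e` ⇒ aloof at `e` (Rmk 2.4.1).
-/

namespace Literature.AnabelianGeometry.SemiGraphs

open CategoryTheory

universe v₁ u₁ u

open SgAQuot SgAQuot.SgA SemiGraphOfAnabelioids

/-- **`LocalAdjectives.ofReal`**: the Def 5.1 (iii) container of local adjectives at the real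
vocabulary — elevated / sub-coverticial / universally sub-coverticial / aloof / estranged are t1's
predicates on the underlying semi-graph of anabelioids (Def 2.4 (i), (iii), (iv)).
[cite: MochizukiSemiAnbd2006, Def 5.1 (iii), p. 63] -/
def LocalAdjectives.ofReal (R : SgA.BridgeResidual.{v₁, u₁, u}) :
    LocalAdjectives (SemiAnbdVocab.ofReal R) where
  IsElevatedAt G v := G.toSgA.IsElevated v
  IsSubcoverticialAt G e := G.toSgA.IsSubCoverticial e
  IsUnivSubcoverticialAt G e := G.toSgA.IsUniversallySubCoverticial e
  IsAloofAt G e := G.toSgA.IsAloof e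
  IsEstrangedAt G e := G.toSgA.IsEstranged e

namespace LocalAdjectives

variable (R : SgA.BridgeResidual.{v₁, u₁, u}) (G : SgA.{v₁, u₁, u})

/-- At the real vocabulary, "totally elevated" (first container) is "elevated at every vertex"
(Def 2.4 (i)). [cite: MochizukiSemiAnbd2006, Def. 2.4(i) p.25] -/
theorem ofReal_isTotallyElevated_iff :
    (SemiAnbdVocab.ofReal R).IsTotallyElevated G ↔
      ∀ v, (LocalAdjectives.ofReal R).IsElevatedAt G v :=
  G.toSgA.isTotallyElevated_iff

/-- At the real vocabulary, "totally estranged" is "estranged at every edge" (Def 2.4 (iv)).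
[cite: MochizukiSemiAnbd2006, Def. 2.4(iv) p.26] -/
theorem ofReal_isTotallyEstranged_iff :
    (SemiAnbdVocab.ofReal R).IsTotallyEstranged G ↔
      ∀ e, (LocalAdjectives.ofReal R).IsEstrangedAt G e :=
  G.toSgA.isTotallyEstranged_iff

/-- At the real vocabulary, "totally universally sub-coverticial" is "universally sub-coverticial at
every closed edge" (Def 2.4 (iii)). [cite: MochizukiSemiAnbd2006, Def. 2.4(iii) p.26] -/
theorem ofReal_isTotallyUnivSubcoverticial_iff :
    (SemiAnbdVocab.ofReal R).IsTotallyUnivSubcoverticial G ↔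
      ∀ e, G.toSgA.graph.IsClosedEdge e → (LocalAdjectives.ofReal R).IsUnivSubcoverticialAt G e :=
  G.toSgA.isTotallyUniversallySubCoverticial_iff

/-- Every object of the ambient category is aloof at every edge (it is totally aloof, Def 2.4 (iv)).
[cite: MochizukiSemiAnbd2006, Def. 2.4(iv) p.26] -/
theorem ofReal_isAloofAt (e : G.toSgA.graph.Edge) : (LocalAdjectives.ofReal R).IsAloofAt G e :=
  G.isTotallyAloof.isAloof e

/-- At the real vocabulary, "estranged at `e`" implies "aloof at `e`" (Rmk 2.4.1, first sentence).
[cite: MochizukiSemiAnbd2006, Rem. 2.4.1 p.26] -/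
theorem ofReal_isAloofAt_of_isEstrangedAt (e : G.toSgA.graph.Edge)
    (h : (LocalAdjectives.ofReal R).IsEstrangedAt G e) : (LocalAdjectives.ofReal R).IsAloofAt G e :=
  SemiGraphOfAnabelioids.IsEstranged.isAloof G.toSgA h

/-- Universally sub-coverticial and sub-coverticial are predicated of CLOSED edges (Def 2.4 (iii)): at
the real vocabulary each implies that the edge is closed. [cite: MochizukiSemiAnbd2006, Def. 2.4(iii) p.25] -/
theorem ofReal_isClosedEdge_of_isSubcoverticialAt (e : G.toSgA.graph.Edge)
    (h : (LocalAdjectives.ofReal R).IsSubcoverticialAt G e) : G.toSgA.graph.IsClosedEdge e :=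
  h.1

end LocalAdjectives

end Literature.AnabelianGeometry.SemiGraphs
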